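import Summits.RiemannHypothesis.RiemannHypothesis.Theses.SpectralTrace
import HarnessLib

/-!
# `WindowTraceArch` — negative lemma: the test-class hypothesis `IsWeilTest` is load-bearing

Support lemmas for the crux `stmt-RiemannHypothesis-11195`
(`Summit.RiemannHypothesis.RiemannHypothesis.Theses.SpectralTrace.WindowTraceArch`), recorded by
the standing disprover (`Cruxes/WindowTraceArch/Disproof.lean` §1).

`windowTraceArch_false_without_isWeilTest` : the crux with the hypothesis `IsWeilTest g` DROPPED
(every `g : ℝ → ℂ` with `tsupport g ⊆ [-log 2, log 2]` is tested) is FALSE. Witness: the null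
spike `𝟙_{0}` has `ĝ ≡ 0` (`weilMellin` sees only the a.e.-class of `g`) while
`W(𝟙_{0}) = -log π ≠ 0` (`weilArchTerm` reads the POINT VALUE `g 0`). So every proof of the crux
uses at least the continuity part of `IsWeilTest`; the statement is about test FUNCTIONS, not
about the measures `g dt`.
-/

noncomputable section

open Complex Set MeasureTheory Filter

namespace Summit.RiemannHypothesis.RiemannHypothesis.Theorems.WindowTraceArch.Negative

open Literature.NumberTheory.LFunctions

/-- `𝟙_{0}(0) = 1`. [folklore] -/
theorem spike_zero : (Set.indicator ({0} : Set ℝ) (fun _ => (1 : ℂ))) 0 = 1 := by simp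

/-- `𝟙_{0}(t) = 0` for `t ≠ 0`. [folklore] -/
theorem spike_of_ne {t : ℝ} (ht : t ≠ 0) :
    (Set.indicator ({0} : Set ℝ) (fun _ => (1 : ℂ))) t = 0 := by simp [ht]

/-- `tsupport 𝟙_{0} ⊆ {0}`. [folklore] -/
theorem tsupport_spike_subset :
    tsupport (Set.indicator ({0} : Set ℝ) (fun _ => (1 : ℂ))) ⊆ ({0} : Set ℝ) :=
  closure_minimal (Set.support_indicator_subset) isClosed_singleton

/-- `weilMellin 𝟙_{0} ≡ 0`: the transform only sees the a.e.-class. [folklore] -/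
theorem weilMellin_spike (s : ℂ) :
    weilMellin (Set.indicator ({0} : Set ℝ) (fun _ => (1 : ℂ))) s = 0 := by
  unfold weilMellin
  refine integral_eq_zero_of_ae ?_
  have hae : ∀ᵐ t : ℝ, t ∉ ({0} : Set ℝ) := compl_mem_ae_iff.2 (measure_singleton (0 : ℝ))
  filter_upwards [hae] with t ht
  simp [spike_of_ne (by simpa using ht)]

/-- No prime power is seen by the spike (`log n = 0` only for `n = 0, 1`, where `Λ = 0`).
[folklore] -/
theorem weilPrimeTerm_spike :
    weilPrimeTerm (Set.indicator ({0} : Set ℝ) (fun _ => (1 : ℂ))) = 0 := by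
  unfold weilPrimeTerm
  refine (tsum_congr fun n => ?_).trans tsum_zero
  rcases Nat.lt_or_ge n 2 with hn | hn
  · interval_cases n <;> simp
  · have hlog : 0 < Real.log n := Real.log_pos (by exact_mod_cast hn)
    rw [spike_of_ne hlog.ne', spike_of_ne (by linarith : -Real.log n ≠ 0)]
    simp

/-- The archimedean term reads the point value `g 0`: `W(𝟙_{0}) = -log π`. [folklore] -/
theorem weilFunctional_spike :
    weilFunctional (Set.indicator ({0} : Set ℝ) (fun _ => (1 : ℂ))) = -(Real.log Real.pi : ℂ) := by
  have hA : weilArchIntegral (Set.indicator ({0} : Set ℝ) (fun _ => (1 : ℂ))) = 0 := by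
    unfold weilArchIntegral
    simp only [weilMellin_spike, zero_mul, integral_zero]
  rw [weilFunctional, weilPolarTerm, weilMellin_spike, weilMellin_spike, weilPrimeTerm_spike,
    weilArchTerm, hA, spike_zero]
  ring

/-- **`IsWeilTest` is load-bearing in `WindowTraceArch`.** With the test-class hypothesis
dropped the window trace identity is false: no real family `γ` satisfies
`HasSum (i ↦ ĝ(1/2+iγ_i)) (W g)` for every `g` with `tsupport g ⊆ [-log 2, log 2]`
(witness `g = 𝟙_{0}`: summands `0`, `W(g) = -log π ≠ 0`). [folklore] -/
theorem windowTraceArch_false_without_isWeilTest :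
    ¬ ∃ (ι : Type) (γ : ι → ℝ), ∀ g : ℝ → ℂ, tsupport g ⊆ Icc (-Real.log 2) (Real.log 2) →
      HasSum (fun i => weilMellin g (1 / 2 + (γ i : ℂ) * I)) (weilFunctional g) := by
  rintro ⟨ι, γ, h⟩
  have hlog2 : 0 ≤ Real.log 2 := Real.log_nonneg one_le_two
  have hsupp :
      tsupport (Set.indicator ({0} : Set ℝ) (fun _ => (1 : ℂ))) ⊆ Icc (-Real.log 2) (Real.log 2) :=
    tsupport_spike_subset.trans (by
      rintro t rfl
      exact ⟨by linarith, hlog2⟩)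
  have hsum := h (Set.indicator ({0} : Set ℝ) (fun _ => (1 : ℂ))) hsupp
  simp only [weilMellin_spike] at hsum
  have h0 : weilFunctional (Set.indicator ({0} : Set ℝ) (fun _ => (1 : ℂ))) = 0 :=
    hsum.unique hasSum_zero
  rw [weilFunctional_spike, neg_eq_zero, Complex.ofReal_eq_zero] at h0
  exact (Real.log_pos (by linarith [Real.pi_gt_three] : (1 : ℝ) < Real.pi)).ne' h0

end Summit.RiemannHypothesis.RiemannHypothesis.Theorems.WindowTraceArch.Negative

end
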